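import Summits.QuantumFields.YangMills.Theorems.BalabanUVNodesN15NeumannCubeDivergenceDefect
import Summits.QuantumFields.YangMills.Theorems.BalabanUVNodesN15TwoGridAveragingDefect
import HarnessLib

/-!
# Route «BalabanUVNodes» (K3⁷), node N15 = NE2, -a lane, PROGRAMME N file N-IIl: THE η-DEFECT OF THE CUBE PROPAGATOR BEHIND BAŁABAN's AVERAGING TERM `Q*Q` —
# `Q*Q` commutes with the images EXACTLY, the own-direction difference of the `Q*` stencil is `O(η)`, and N-IIg's sandwich closes (dag-n15-c WANT-n15-a (g12-4), part 1 of 2)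

Cell `pub-ymgap`, seat `pub-ymgap-dag-n15-a` (KNIT-BY-NAME, g21; D-0062; chair R424 venue; `bears_on: R4∕N15`); `--kind proof --supports stmt-QuantumFields-20544 --as helper`.
Over N-IIg `…NeumannCubeDivergenceDefect` (★★★ `idef_chiCube_symOp_sandwich` — the EXACT η-defect of `χ∘Sym∘X∘χ` for ANY `X`; `hasMaj_faceTerm`, `hasMaj_chiCube_symOp_comp`), N-IIIa
`symOp_comp_deltaOp`, part 39 `deltaOp_eq`, part 45 §36 (`hasMaj_qvRe_comp`, `hasMaj_qvAdjRe_comp`, ★ `hasMaj_qvRe_pull_sub_comp`, ★ `hasMaj_qvAdjRe_sub_pull_comp`), part 20 (`lineWeight`).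
dag-n15-c g12 I.31964 WANT-n15-a (g12-4): «`hasMaj_idef_chiCube_nonlocal_neumannCubeG` — the η-defect of `χ_□∘(a•Q*Q − ∂Π∂*)∘G(□)` at two spacings; N-IIk's `hDT` fails for `Q*Q` (a two-grid defect
only on differentiable inputs)».  THIS FILE: the `Q*Q` half.  N-IIm `…NeumannCubeNonlocalDefect`: the Landau half (N-IIk verbatim) and the assembly.

THE POINT.  `Q*Q ∘ Sym = Sym ∘ Q*Q` EXACTLY (★ `qq_comp_symOp`: `Q*Q = Δ₁ − Δ₀` by `deltaOp_eq`, and `Sym` commutes with every `Δ_a`), so `χ_□∘Q*Q∘G(□) = χ_□∘Sym∘(Q*Q∘G)∘M_{χ_□}` is an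
images-dressed SANDWICH and N-IIg's exact identity applies with `X := Q*Q∘G`: the torus defect `𝔇(Q*′Q′G′, Q*QG) = Q*′Q′∘𝔇(G′,G) + Q*′(Q′P − Q)G + (Q*′ − PQ*)QG` (★★ `hasMaj_idef_qq_gOp`,
parts 43∕44∕45 on the TORUS `G`: rate `C₀ + O(1∕L^k)`), and the face term `Σ_T mask∘P∘χ∘R_T∘(D∘Q*QG∘χ)` sees only the OWN-direction difference `D` of the `Q*` stencil — a linear
interpolation along the line: ★ `lineWeight_add_unitVec_sub` (`n(θ_n(x+e_κ,z) − θ_n(x,z)) = 1_{B(x+e_κ)=z} − 1_{B(x−(n−1)e_κ)=z}`), ★★ `hasMaj_ownDiff_comp_qvAdjRe` (`D∘Q*∘S ≤ (2e^{ρ}∕n)·B·e^{−ρd}`)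
— whereas the transverse one-step jumps of `Q*v` are `O(|∇^{unit}v|)` and N-IIg's all-direction `h1` would NOT be small (located: the identity hidden in `Q*QG = a⁻¹(1 − ΔG + VG)` makes every
all-direction route fail at the seams, where King's prolongation of the coarse seam layer is an `L^r`-slab).
§37 ★ `qq_eq_deltaOp_sub`, ★ `qq_comp_symOp`, `mulOp_chiCube_qq_neumannCubeG` (`χ∘(Q*Q)∘G(□) = χ∘Sym∘((Q*Q)∘G)∘M_χ`).
§38 ★ `lineWeight_mul_eq_sum`, `tstep_pred_add_unitVec`, ★ `lineWeight_add_unitVec_sub`, ★★ `hasMaj_ownDiff_comp_qvAdjRe`.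
§39 ★★ `hasMaj_idef_chiCube_symOp_sandwich_of_ownDiff` (N-IIg's letter lemma with the `ownDiff` row as hypothesis instead of all one-step differences), ★ `idef_qq_comp` (algebra),
★★ `hasMaj_idef_qq_gOp`, ★★ `hasMaj_ownDiff_qq_gOp`, ★★★ `hasMaj_idef_chiCube_qq_neumannCubeG_of` — THE `Q*Q` ROW from the three torus letters `G ≤ Ce^{−δd}` (`hG`), `𝔇(G′,G) ≤ C₀e^{−δd}`
(`h0`), `∇_νG ≤ C₁e^{−δd}` (`h1`): `𝔇(χ′Q*′Q′G′(□), χQ*QG(□)) ≤ 1_□(y)1_□(y′)·2^{d+1}e^{δ}·e^{2δ}·(C₀ + (C₁ + 4C)∕L^k)·e^{−δ|y−y′|_T}` (any torus `M_ν = 2S`, `n = L^k`, `n′ = L^r·n`).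
v1.0.1 (doc only, ref-B READ-818 NIT-L1 ×2): header constant aligned with the theorem; King's Prop. 3.9 locator p.665.
HONEST FRAMING.  Block-majorant bookkeeping over LANDED letters + one stencil identity for Bałaban's `Q*` ((1.18)); no new analytic estimate; `U ≡ 1` torus MODEL of [B5] §1; [B9] Thm 3.14 =
difference TEMPLATE only; nothing of [B6] (2.38)–(2.40) ∕ [B9] asserted; N15 NOT discharged (object-bound; NE2⁺ NOT PRINTED); counts UNMOVED (typed 28∕28 · discharged 5∕27); finite tori —
NOT continuum ∕ ℝ⁴ ∕ OS ∕ mass gap ∕ Clay.  Theorems only (0 def).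
-/

noncomputable section

open scoped BigOperators Matrix
open Finset

namespace Summit.QuantumFields.YangMills.BalabanUVNodes.N15.TwoGrid

open Literature.MathematicalPhysics.QuantumFieldTheory.Balaban1983to89
open Literature.MathematicalPhysics.QuantumFieldTheory.Balaban1983to89.B5Prop11Plancherel (Tor fine unitVec)
open Literature.MathematicalPhysics.QuantumFieldTheory.Balaban1983to89.B5Block118 (up bpt tstep tstep_zero tstep_succ)
open Literature.MathematicalPhysics.QuantumFieldTheory.Balaban1983to89.B6Prop26Gluing (mulOp mulOp_apply ind ind_nonneg ind_le_one)
open Literature.MathematicalPhysics.QuantumFieldTheory.King1986.Torus (blockOf tdistT tdistT_symm tdistT_nonneg tdistT_triangle tdistT_self)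
open Literature.MathematicalPhysics.QuantumFieldTheory.Balaban1983to89.B11SectG (BlockNorm HasMaj)
open Literature.MathematicalPhysics.QuantumFieldTheory.Balaban1983to89.B11AxialTransport190 (abs_le_loc_ofBlocks loc_ofBlocks_le)
open Literature.MathematicalPhysics.QuantumFieldTheory.Balaban1983to89.B6UnitTorusCarrier (unitTorusGeo)
open Literature.MathematicalPhysics.QuantumFieldTheory.Balaban1983to89.T4EtaRateDefect (idef idef_comp idef_apply)
open Literature.MathematicalPhysics.QuantumFieldTheory.Balaban1983to89.T4EtaRateCoeffDefect (pull pull_apply)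
open Summit.QuantumFields.YangMills.BalabanUVNodes.N15.VectorPiece (blkFine kingPr kingPrV blkFine_comp_kingPrV lineWeight lineWeight_nonneg tdistT_blockOf_sub_tstep_le
  tdistT_blockOf_sub_unitVec_le)

variable {d : ℕ}

/-! ## §37 `Q*Q` commutes with the images exactly -/

section Commute

variable (M : Fin (d + 1) → ℕ) [∀ μ, NeZero (M μ)] (n : ℕ) [NeZero n] (c : Tor M)

/-- ★ `Q*Q = Δ₁ − Δ₀` (part 39 `deltaOp_eq`: `Δ_a = ρ(sLap) − V + a·Q*Q` at `a = 1, 0`). [cite: Balaban1984PropagatorsI, (1.69) p.29, (1.73) p.30] -/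
theorem qq_eq_deltaOp_sub : qvAdjRe M n ∘ₗ qvRe M n = deltaOp M n 1 - deltaOp M n 0 := by
  rw [deltaOp_eq M n 1, deltaOp_eq M n 0, one_smul, zero_smul, add_zero, add_sub_cancel_left]

/-- ★ **`Q*Q` COMMUTES WITH THE SYMMETRISER EXACTLY**: `(Q*Q) ∘ Sym = Sym ∘ (Q*Q)` — `Sym` commutes with every `Δ_a` (N-IIIa `symOp_comp_deltaOp`) and `Q*Q = Δ₁ − Δ₀`.
[cite: Balaban1984PropagatorsII, (2.37) p.229 (images); Balaban1984PropagatorsI, (1.69) p.29] -/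
theorem qq_comp_symOp : (qvAdjRe M n ∘ₗ qvRe M n) ∘ₗ symOp M n c = symOp M n c ∘ₗ (qvAdjRe M n ∘ₗ qvRe M n) := by
  rw [qq_eq_deltaOp_sub, LinearMap.sub_comp, LinearMap.comp_sub, symOp_comp_deltaOp, symOp_comp_deltaOp]

variable (S : ℕ) {a : ℝ}

/-- `χ_□ ∘ (Q*Q) ∘ G(□ + c) = χ_□ ∘ Sym ∘ ((Q*Q) ∘ G) ∘ M_{χ_□}` pointwise (`G(□) = Sym∘G∘M_{χ_□}`, N-IIb). [cite: Balaban1984PropagatorsII, (2.37) p.229] -/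
theorem mulOp_chiCube_qq_neumannCubeG (hM : ∀ ν, M ν = 2 * S) (hn : 1 ≤ n) (ha : 0 < a) (f : Tor (fine n M) × Fin (d + 1) → ℝ) :
    (mulOp (chiCube M n c S) ∘ₗ ((qvAdjRe M n ∘ₗ qvRe M n) ∘ₗ neumannCubeG M n c S a)) f =
      (mulOp (chiCube M n c S) ∘ₗ symOp M n c ∘ₗ ((qvAdjRe M n ∘ₗ qvRe M n) ∘ₗ gOp M n a) ∘ₗ mulOp (chiCube M n c S)) f := by
  have h := LinearMap.congr_fun (qq_comp_symOp M n c) (gOp M n a (mulOp (chiCube M n c S) f))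
  simp only [LinearMap.comp_apply] at h ⊢
  rw [neumannCubeG_eq_chiCube M n c S a hM hn ha]
  simp only [LinearMap.comp_apply]
  rw [h]

end Commute

/-! ## §38 The own-direction difference of Bałaban's `Q*` stencil is `O(η)` -/

section Stencil

variable (M : Fin (d + 1) → ℕ) [∀ μ, NeZero (M μ)] (n : ℕ) [NeZero n]

/-- ★ the stencil weight as a line sum: `n·θ_n(x, z; κ) = Σ_{t<n} 1_{B(x − te_κ) = z}`. [cite: Balaban1984PropagatorsI, (1.18) p.20] -/
theorem lineWeight_mul_eq_sum (κ : Fin (d + 1)) (x : Tor (fine n M)) (z : Tor M) :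
    (n : ℝ) * lineWeight n M κ x z = ∑ t ∈ range n, if blockOf n M (x - tstep (fine n M) κ t) = z then (1 : ℝ) else 0 := by
  classical
  have hn : (n : ℝ) ≠ 0 := Nat.cast_ne_zero.mpr (NeZero.ne n)
  unfold lineWeight
  rw [mul_comm, div_mul_cancel₀ _ hn, Finset.card_filter, Nat.cast_sum]
  simp only [Nat.cast_ite, Nat.cast_one, Nat.cast_zero]
  exact Fin.sum_univ_eq_sum_range (fun t => if blockOf n M (x - tstep (fine n M) κ t) = z then (1 : ℝ) else 0) n

omit [∀ μ, NeZero (M μ)] in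
/-- `ne_κ = (n−1)e_κ + e_κ` (`n ≥ 1`). [folklore] -/
theorem tstep_pred_add_unitVec (κ : Fin (d + 1)) : tstep (fine n M) κ n = tstep (fine n M) κ (n - 1) + unitVec (fine n M) κ := by
  rw [← tstep_succ, Nat.sub_add_cancel (Nat.one_le_iff_ne_zero.mpr (NeZero.ne n))]

/-- ★ **THE OWN-DIRECTION DIFFERENCE OF THE `Q*` STENCIL**: `n·(θ_n(x + e_κ, z; κ) − θ_n(x, z; κ)) = 1_{B(x+e_κ) = z} − 1_{B(x−(n−1)e_κ) = z}` — the backward lines from `x + e_κ` and from `x`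
share `n − 1` points. [cite: Balaban1984PropagatorsI, (1.18) p.20 (the stencil of Q*)] -/
theorem lineWeight_add_unitVec_sub (κ : Fin (d + 1)) (x : Tor (fine n M)) (z : Tor M) :
    (n : ℝ) * (lineWeight n M κ (x + unitVec (fine n M) κ) z - lineWeight n M κ x z) =
      (if blockOf n M (x + unitVec (fine n M) κ) = z then (1 : ℝ) else 0) - (if blockOf n M (x - tstep (fine n M) κ (n - 1)) = z then (1 : ℝ) else 0) := by
  classical
  rw [mul_sub, lineWeight_mul_eq_sum, lineWeight_mul_eq_sum]
  set g : ℕ → ℝ := fun t => if blockOf n M (x + unitVec (fine n M) κ - tstep (fine n M) κ t) = z then (1 : ℝ) else 0 with hg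
  have h1 : ∑ t ∈ range n, (if blockOf n M (x - tstep (fine n M) κ t) = z then (1 : ℝ) else 0) = ∑ t ∈ range n, g (t + 1) := by
    refine sum_congr rfl fun t _ => ?_
    rw [hg]
    simp only [tstep_succ, add_sub_add_right_eq_sub]
  have h2 : ∑ t ∈ range n, (if blockOf n M (x + unitVec (fine n M) κ - tstep (fine n M) κ t) = z then (1 : ℝ) else 0) = ∑ t ∈ range n, g t := rfl
  rw [h1, h2, ← Finset.sum_sub_distrib, Finset.sum_range_sub', hg]
  simp only [tstep_zero, sub_zero, tstep_pred_add_unitVec M n κ, add_sub_add_right_eq_sub]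

variable {L k : ℕ} {F₁ : Type} [AddCommGroup F₁] [Module ℝ F₁]

/-- ★★ **THE OWN-DIRECTION DIFFERENCE OF `Q*` IS `O(η)` IN BLOCK-MAJORANT FORM**: if `S` has majorant `B·e^{−ρd}` into unit-lattice 1-forms blocked by their site, then `D ∘ Q* ∘ S`
(`D` = N-IIa's `ownDiff`, the un-normalised one-step difference in the bond's OWN direction; `Q* = qvAdjRe M n`) has majorant `(2e^{ρ}∕n)·B·e^{−ρd}` into fine 1-forms blocked by King's unit blocks:
`(DQ*v)(x, κ) = n⁻¹(v(B(x+e_κ), κ) − v(B(x−(n−1)e_κ), κ))`, both blocks within one of `B(x)`.  (The transverse one-step jumps of `Q*v` are NOT small.)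
[cite: Balaban1984PropagatorsI, (1.18) p.20 (the stencil of Q*); King1986, Prop. 3.9 p.665 (η-rate shape)] -/
theorem hasMaj_ownDiff_comp_qvAdjRe {b₁ : BlockNorm (unitTorusGeo L k M) F₁} {S : F₁ →ₗ[ℝ] (Tor M × Fin (d + 1) → ℝ)} {B ρ : ℝ} (hB : 0 ≤ B) (hρ : 0 ≤ ρ)
    (h : HasMaj b₁ (BlockNorm.ofBlocks (unitTorusGeo L k M) (fun b : Tor M × Fin (d + 1) => b.1)) S (fun y y' => B * Real.exp (-(ρ * tdistT M y y')))) :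
    HasMaj b₁ (BlockNorm.ofBlocks (unitTorusGeo L k M) (fun i : Tor (fine n M) × Fin (d + 1) => blockOf n M i.1)) (ownDiff M n ∘ₗ qvAdjRe M n ∘ₗ S)
      (fun y y' => 2 * Real.exp ρ / n * B * Real.exp (-(ρ * tdistT M y y'))) := by
  classical
  have hn0 : (0 : ℝ) < n := by exact_mod_cast Nat.pos_of_ne_zero (NeZero.ne n)
  have hn1 : n - 1 < n := Nat.sub_lt (Nat.pos_of_ne_zero (NeZero.ne n)) Nat.one_pos
  intro y' μ hμ y
  have hK0 : 0 ≤ 2 * Real.exp ρ / n * B * Real.exp (-(ρ * tdistT M y y')) := by positivity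
  refine loc_ofBlocks_le (g := unitTorusGeo L k M) (fun i : Tor (fine n M) × Fin (d + 1) => blockOf n M i.1) _ (mul_nonneg hK0 (b₁.loc_nonneg y' μ)) fun i hi => ?_
  obtain ⟨x, κ⟩ := i
  simp only at hi
  -- the sizes of `Sμ` on the unit blocks within one of `B(x) = y`
  have hv : ∀ z : Tor M, tdistT M z y ≤ 1 → |S μ (z, κ)| ≤ B * Real.exp ρ * Real.exp (-(ρ * tdistT M y y')) * b₁.loc y' μ := by
    intro z hd1
    have h0 : |S μ (z, κ)| ≤ B * Real.exp (-(ρ * tdistT M z y')) * b₁.loc y' μ :=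
      (abs_le_loc_ofBlocks (g := unitTorusGeo L k M) (fun b : Tor M × Fin (d + 1) => b.1) (S μ) (x' := (z, κ)) rfl).trans (h y' μ hμ z)
    refine h0.trans (mul_le_mul_of_nonneg_right ?_ (b₁.loc_nonneg y' μ))
    rw [mul_assoc, ← Real.exp_add]
    refine mul_le_mul_of_nonneg_left (Real.exp_le_exp.mpr ?_) hB
    have ht := tdistT_triangle M y z y'
    rw [tdistT_symm M y z] at ht
    nlinarith
  -- the own-direction difference of the stencil
  have hdiff : (ownDiff M n ∘ₗ qvAdjRe M n ∘ₗ S) μ (x, κ) =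
      (n : ℝ)⁻¹ * (S μ (blockOf n M (x + unitVec (fine n M) κ), κ) - S μ (blockOf n M (x - tstep (fine n M) κ (n - 1)), κ)) := by
    rw [LinearMap.comp_apply, LinearMap.comp_apply, ownDiff_apply]
    simp only
    rw [qvAdjRe_apply, qvAdjRe_apply, ← Finset.sum_sub_distrib]
    simp only
    have hterm : ∀ z : Tor M, lineWeight n M κ (x + unitVec (fine n M) κ) z * S μ (z, κ) - lineWeight n M κ x z * S μ (z, κ) =
        (n : ℝ)⁻¹ * (((if blockOf n M (x + unitVec (fine n M) κ) = z then (1 : ℝ) else 0) -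
          (if blockOf n M (x - tstep (fine n M) κ (n - 1)) = z then (1 : ℝ) else 0)) * S μ (z, κ)) := by
      intro z
      have e : lineWeight n M κ (x + unitVec (fine n M) κ) z - lineWeight n M κ x z =
          (n : ℝ)⁻¹ * ((if blockOf n M (x + unitVec (fine n M) κ) = z then (1 : ℝ) else 0) -
            (if blockOf n M (x - tstep (fine n M) κ (n - 1)) = z then (1 : ℝ) else 0)) := by
        rw [← lineWeight_add_unitVec_sub M n κ x z, inv_mul_cancel_left₀ hn0.ne']
      rw [← sub_mul, e, mul_assoc]
    rw [Finset.sum_congr rfl fun z _ => hterm z, ← Finset.mul_sum]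
    congr 1
    simp only [sub_mul, Finset.sum_sub_distrib, ite_mul, one_mul, zero_mul, Finset.sum_ite_eq, Finset.mem_univ, if_true]
  rw [hdiff, abs_mul, abs_inv, Nat.abs_cast]
  have hz₁ : tdistT M (blockOf n M (x + unitVec (fine n M) κ)) y ≤ 1 := by
    have h' := tdistT_blockOf_sub_unitVec_le n M (x + unitVec (fine n M) κ) κ
    rw [add_sub_cancel_right, hi, tdistT_symm] at h'
    exact h'
  have hz₂ : tdistT M (blockOf n M (x - tstep (fine n M) κ (n - 1))) y ≤ 1 := by
    have h' := tdistT_blockOf_sub_tstep_le n M x κ hn1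
    rw [hi] at h'
    exact h'
  calc (n : ℝ)⁻¹ * |S μ (blockOf n M (x + unitVec (fine n M) κ), κ) - S μ (blockOf n M (x - tstep (fine n M) κ (n - 1)), κ)|
      ≤ (n : ℝ)⁻¹ * (B * Real.exp ρ * Real.exp (-(ρ * tdistT M y y')) * b₁.loc y' μ + B * Real.exp ρ * Real.exp (-(ρ * tdistT M y y')) * b₁.loc y' μ) :=
        mul_le_mul_of_nonneg_left ((abs_sub _ _).trans (add_le_add (hv _ hz₁) (hv _ hz₂))) (inv_nonneg.mpr hn0.le)
    _ = 2 * Real.exp ρ / n * B * Real.exp (-(ρ * tdistT M y y')) * b₁.loc y' μ := by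
        field_simp
        ring

end Stencil

/-! ## §39 The `Q*Q` row: N-IIg's sandwich with the own-direction face letter; the torus defect of `Q*Q∘G` from parts 43∕44∕45 -/

section Row

variable {L : ℕ} [NeZero L] {M : Fin (d + 1) → ℕ} [∀ μ, NeZero (M μ)] {k r : ℕ} {c : Tor M} {S : ℕ}

/-- ★★ **N-IIg's SANDWICH LETTER WITH THE OWN-DIRECTION FACE ROW AS HYPOTHESIS** (any torus `M_ν = 2S`, `n = L^k`, `n′ = L^r·n`, any pair `X′, X`): the torus defect
`𝔇(X′, X) ≤ C₀e^{−δd}` and the OWN-direction one-step row `D∘X ≤ C_De^{−δd}` (`D` = N-IIa's `ownDiff`; the smallness is inside `C_D`) give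
`𝔇(χ′Sym′X′χ′, χSymXχ) ≤ 1_□1_□·2^{d+1}e^{δ}(C₀ + C_D)·e^{−δd}` — N-IIg `hasMaj_idef_chiCube_symOp_sandwich_of` asks all one-step differences, which is too much for `X = Q*QG`.
[cite: Balaban1985BackgroundPropagators, Thm 3.14 pp.426–427, (3.42) p.397 (shape); Balaban1984PropagatorsII, (2.133)–(2.134) p.247 (shapes), (2.37) p.229] -/
theorem hasMaj_idef_chiCube_symOp_sandwich_of_ownDiff (hM : ∀ ν, M ν = 2 * S)
    {X' : (Tor (fine (L ^ r * L ^ k) M) × Fin (d + 1) → ℝ) →ₗ[ℝ] (Tor (fine (L ^ r * L ^ k) M) × Fin (d + 1) → ℝ)}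
    {X : (Tor (fine (L ^ k) M) × Fin (d + 1) → ℝ) →ₗ[ℝ] (Tor (fine (L ^ k) M) × Fin (d + 1) → ℝ)} {C₀ CD δ : ℝ} (hC₀ : 0 ≤ C₀) (hCD : 0 ≤ CD) (hδ : 0 ≤ δ)
    (h0 : HasMaj (BlockNorm.ofBlocks (unitTorusGeo L k M) (fun b : Tor (fine (L ^ k) M) × Fin (d + 1) => blockOf (L ^ k) M b.1))
      (BlockNorm.ofBlocks (unitTorusGeo L k M) (fun b' : Tor (fine (L ^ r * L ^ k) M) × Fin (d + 1) => blockOf (L ^ r * L ^ k) M b'.1))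
      (idef (pull (kingPrV L k r M)) (pull (kingPrV L k r M)) X' X) (fun y y' => C₀ * Real.exp (-(δ * tdistT M y y'))))
    (hD : HasMaj (BlockNorm.ofBlocks (unitTorusGeo L k M) (fun b : Tor (fine (L ^ k) M) × Fin (d + 1) => blockOf (L ^ k) M b.1))
      (BlockNorm.ofBlocks (unitTorusGeo L k M) (fun b : Tor (fine (L ^ k) M) × Fin (d + 1) => blockOf (L ^ k) M b.1))
      (ownDiff M (L ^ k) ∘ₗ X) (fun y y' => CD * Real.exp (-(δ * tdistT M y y')))) :
    HasMaj (BlockNorm.ofBlocks (unitTorusGeo L k M) (fun b : Tor (fine (L ^ k) M) × Fin (d + 1) => blockOf (L ^ k) M b.1))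
      (BlockNorm.ofBlocks (unitTorusGeo L k M) (fun b' : Tor (fine (L ^ r * L ^ k) M) × Fin (d + 1) => blockOf (L ^ r * L ^ k) M b'.1))
      (idef (pull (kingPrV L k r M)) (pull (kingPrV L k r M))
        (mulOp (chiCube M (L ^ r * L ^ k) c S) ∘ₗ symOp M (L ^ r * L ^ k) c ∘ₗ X' ∘ₗ mulOp (chiCube M (L ^ r * L ^ k) c S))
        (mulOp (chiCube M (L ^ k) c S) ∘ₗ symOp M (L ^ k) c ∘ₗ X ∘ₗ mulOp (chiCube M (L ^ k) c S)))
      (fun y y' => ind (cubeBlocks M c S : Set (Tor M)) y * ind (cubeBlocks M c S : Set (Tor M)) y' *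
        (2 ^ (d + 1) * Real.exp δ * (C₀ + CD) * Real.exp (-(δ * tdistT M y y')))) := by
  rw [idef_chiCube_symOp_sandwich L k r c S X' X]
  have hT1 := hasMaj_chiCube_symOp_comp hC₀ hδ hM (hasMaj_comp_mulOp_chiCube (c := c) (S := S) (fun _ _ => mul_nonneg hC₀ (Real.exp_nonneg _)) h0)
  have hX : HasMaj (BlockNorm.ofBlocks (unitTorusGeo L k M) (fun b : Tor (fine (L ^ k) M) × Fin (d + 1) => blockOf (L ^ k) M b.1))
      (BlockNorm.ofBlocks (unitTorusGeo L k M) (fun b : Tor (fine (L ^ k) M) × Fin (d + 1) => blockOf (L ^ k) M b.1))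
      (ownDiff M (L ^ k) ∘ₗ X ∘ₗ mulOp (chiCube M (L ^ k) c S))
      (fun y y' => ind (cubeBlocks M c S : Set (Tor M)) y' * (CD * Real.exp (-(δ * tdistT M y y')))) :=
    (hasMaj_comp_mulOp_chiCube (c := c) (S := S) (fun _ _ => mul_nonneg hCD (Real.exp_nonneg _)) hD).congr fun μ => rfl
  have hsum := hasMaj_finsum (Finset.univ : Finset (Fin (d + 1))).powerset _ _ fun T _ => hasMaj_faceTerm (r := r) (c := c) hM hCD hδ T hX
  refine (hT1.add hsum).mono fun y y' => le_of_eq ?_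
  rw [Finset.sum_const, Finset.card_powerset, Finset.card_univ, Fintype.card_fin, nsmul_eq_mul]
  push_cast
  ring

/-- ★ the two-grid defect of `Q*Q∘G`, split: `𝔇(Q*′Q′G′, Q*QG) = Q*′Q′∘𝔇(G′,G) + Q*′∘(Q′P − Q)∘G + (Q*′ − PQ*)∘Q∘G` (Leibniz + telescoping). [folklore] -/
theorem idef_qq_comp (a : ℝ) :
    idef (pull (kingPrV L k r M)) (pull (kingPrV L k r M)) ((qvAdjRe M (L ^ r * L ^ k) ∘ₗ qvRe M (L ^ r * L ^ k)) ∘ₗ gOp M (L ^ r * L ^ k) a)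
        ((qvAdjRe M (L ^ k) ∘ₗ qvRe M (L ^ k)) ∘ₗ gOp M (L ^ k) a) =
      qvAdjRe M (L ^ r * L ^ k) ∘ₗ (qvRe M (L ^ r * L ^ k) ∘ₗ idef (pull (kingPrV L k r M)) (pull (kingPrV L k r M)) (gOp M (L ^ r * L ^ k) a) (gOp M (L ^ k) a)) +
        (qvAdjRe M (L ^ r * L ^ k) ∘ₗ ((qvRe M (L ^ r * L ^ k) ∘ₗ pull (kingPrV L k r M) - qvRe M (L ^ k)) ∘ₗ gOp M (L ^ k) a) +
          (qvAdjRe M (L ^ r * L ^ k) - pull (kingPrV L k r M) ∘ₗ qvAdjRe M (L ^ k)) ∘ₗ (qvRe M (L ^ k) ∘ₗ gOp M (L ^ k) a)) := by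
  refine LinearMap.ext fun f => ?_
  simp only [idef_apply, LinearMap.comp_apply, LinearMap.add_apply, LinearMap.sub_apply, map_sub]
  abel

/-- ★★ **THE TWO-GRID DEFECT OF `Q*Q∘G` ON THE TORUS** from the three torus letters (`G ≤ Ce^{−δd}`, `𝔇(G′,G) ≤ C₀e^{−δd}`, `∇_νG ≤ C₁e^{−δd}`):
`𝔇(Q*′Q′G′, Q*QG) ≤ e^{2δ}(C₀ + (C₁ + 2C)∕L^k)·e^{−δd}` — `Q′`, `Q*′` keep letters up to `e^{δ}` each (part 45 §36), `(Q′P − Q)G = O(η)` from the coarse gradients (part 44∕45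
`hasMaj_qvRe_pull_sub_comp`), `(Q*′ − PQ*)QG = O(η)` by the stencil comparison (part 45 `hasMaj_qvAdjRe_sub_pull_comp`).
[cite: Balaban1984PropagatorsI, (1.18) p.20, Prop. 1.2 (1.110) p.35; King1986, Prop. 3.9 p.665 (η-rate shape), p.664 (pairing)] -/
theorem hasMaj_idef_qq_gOp {a C C₀ C₁ δ : ℝ} (hC : 0 ≤ C) (hC₀ : 0 ≤ C₀) (hC₁ : 0 ≤ C₁) (hδ : 0 ≤ δ)
    (hG : HasMaj (BlockNorm.ofBlocks (unitTorusGeo L k M) (fun b : Tor (fine (L ^ k) M) × Fin (d + 1) => blockOf (L ^ k) M b.1))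
      (BlockNorm.ofBlocks (unitTorusGeo L k M) (fun b : Tor (fine (L ^ k) M) × Fin (d + 1) => blockOf (L ^ k) M b.1)) (gOp M (L ^ k) a)
      (fun y y' => C * Real.exp (-(δ * tdistT M y y'))))
    (h0 : HasMaj (BlockNorm.ofBlocks (unitTorusGeo L k M) (fun b : Tor (fine (L ^ k) M) × Fin (d + 1) => blockOf (L ^ k) M b.1))
      (BlockNorm.ofBlocks (unitTorusGeo L k M) (fun b' : Tor (fine (L ^ r * L ^ k) M) × Fin (d + 1) => blockOf (L ^ r * L ^ k) M b'.1))
      (idef (pull (kingPrV L k r M)) (pull (kingPrV L k r M)) (gOp M (L ^ r * L ^ k) a) (gOp M (L ^ k) a)) (fun y y' => C₀ * Real.exp (-(δ * tdistT M y y'))))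
    (h1 : ∀ ν, HasMaj (BlockNorm.ofBlocks (unitTorusGeo L k M) (fun b : Tor (fine (L ^ k) M) × Fin (d + 1) => blockOf (L ^ k) M b.1))
      (BlockNorm.ofBlocks (unitTorusGeo L k M) (fun b : Tor (fine (L ^ k) M) × Fin (d + 1) => blockOf (L ^ k) M b.1))
      (symbOp M (L ^ k) (sD M (L ^ k) ν ((L ^ k : ℕ) : ℝ)) ∘ₗ gOp M (L ^ k) a) (fun y y' => C₁ * Real.exp (-(δ * tdistT M y y')))) :
    HasMaj (BlockNorm.ofBlocks (unitTorusGeo L k M) (fun b : Tor (fine (L ^ k) M) × Fin (d + 1) => blockOf (L ^ k) M b.1))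
      (BlockNorm.ofBlocks (unitTorusGeo L k M) (fun b' : Tor (fine (L ^ r * L ^ k) M) × Fin (d + 1) => blockOf (L ^ r * L ^ k) M b'.1))
      (idef (pull (kingPrV L k r M)) (pull (kingPrV L k r M)) ((qvAdjRe M (L ^ r * L ^ k) ∘ₗ qvRe M (L ^ r * L ^ k)) ∘ₗ gOp M (L ^ r * L ^ k) a)
        ((qvAdjRe M (L ^ k) ∘ₗ qvRe M (L ^ k)) ∘ₗ gOp M (L ^ k) a))
      (fun y y' => Real.exp δ * Real.exp δ * (C₀ + (C₁ + 2 * C) / (L ^ k : ℕ)) * Real.exp (-(δ * tdistT M y y'))) := by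
  have hL0 : (0 : ℝ) < L := by exact_mod_cast Nat.pos_of_ne_zero (NeZero.ne L)
  have hn0 : (0 : ℝ) < ((L ^ k : ℕ) : ℝ) := by exact_mod_cast Nat.one_le_pow k L (Nat.pos_of_ne_zero (NeZero.ne L))
  have hnL : ((L ^ k : ℕ) : ℝ) = (L : ℝ) ^ k := by push_cast; ring
  -- (a) `Q*′Q′∘𝔇(G′,G)`
  have hA := hasMaj_qvAdjRe_comp M k (L ^ r * L ^ k) (by positivity : 0 ≤ C₀ * Real.exp δ) hδ (hasMaj_qvRe_comp M k (L ^ r * L ^ k) hC₀ hδ h0)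
  -- (b) `Q*′∘(Q′P − Q)∘G` from the `η⁻¹`-normalised coarse gradients
  have hgrad : ∀ κ, HasMaj (BlockNorm.ofBlocks (unitTorusGeo L k M) (fun b : Tor (fine (L ^ k) M) × Fin (d + 1) => blockOf (L ^ k) M b.1))
      (BlockNorm.ofBlocks (unitTorusGeo L k M) (blkFine L k M))
      ((((L ^ k : ℕ) : ℝ)⁻¹ • symbOp M (L ^ k) (sD M (L ^ k) κ ((L ^ k : ℕ) : ℝ))) ∘ₗ gOp M (L ^ k) a)
      (fun y y' => C₁ / ((L ^ k : ℕ) : ℝ) * Real.exp (-(δ * tdistT M y y'))) := by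
    intro κ
    rw [LinearMap.smul_comp]
    refine (hasMaj_smul_ofBlocks _ (fun _ _ => mul_nonneg hC₁ (Real.exp_nonneg _)) _ (h1 κ)).mono fun y y' => le_of_eq ?_
    rw [abs_of_nonneg (inv_nonneg.mpr hn0.le)]
    ring
  have hB := hasMaj_qvAdjRe_comp M k (L ^ r * L ^ k) (by positivity : 0 ≤ C₁ / ((L ^ k : ℕ) : ℝ) * Real.exp δ) hδ
    (hasMaj_qvRe_pull_sub_comp M k r (by positivity : 0 ≤ C₁ / ((L ^ k : ℕ) : ℝ)) hδ hgrad)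
  -- (c) `(Q*′ − PQ*)∘Q∘G` by the stencil comparison
  have hCc := hasMaj_qvAdjRe_sub_pull_comp M k r (by positivity : 0 ≤ C * Real.exp δ) hδ (hasMaj_qvRe_comp M k (L ^ k) hC hδ hG)
  rw [idef_qq_comp]
  refine (hA.add (hB.add hCc)).mono fun y y' => le_of_eq ?_
  rw [hnL]
  field_simp

/-- ★★ **THE OWN-DIRECTION FACE ROW OF `Q*Q∘G`**: `D∘(Q*Q∘G) ≤ (2e^{δ}∕L^k)·Ce^{δ}·e^{−δd}` (§38 `hasMaj_ownDiff_comp_qvAdjRe` behind `Q∘G ≤ Ce^{δ}e^{−δd}`).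
[cite: Balaban1984PropagatorsI, (1.18) p.20, Prop. 1.2 (1.110) p.35] -/
theorem hasMaj_ownDiff_qq_gOp {a C δ : ℝ} (hC : 0 ≤ C) (hδ : 0 ≤ δ)
    (hG : HasMaj (BlockNorm.ofBlocks (unitTorusGeo L k M) (fun b : Tor (fine (L ^ k) M) × Fin (d + 1) => blockOf (L ^ k) M b.1))
      (BlockNorm.ofBlocks (unitTorusGeo L k M) (fun b : Tor (fine (L ^ k) M) × Fin (d + 1) => blockOf (L ^ k) M b.1)) (gOp M (L ^ k) a)
      (fun y y' => C * Real.exp (-(δ * tdistT M y y')))) :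
    HasMaj (BlockNorm.ofBlocks (unitTorusGeo L k M) (fun b : Tor (fine (L ^ k) M) × Fin (d + 1) => blockOf (L ^ k) M b.1))
      (BlockNorm.ofBlocks (unitTorusGeo L k M) (fun b : Tor (fine (L ^ k) M) × Fin (d + 1) => blockOf (L ^ k) M b.1))
      (ownDiff M (L ^ k) ∘ₗ ((qvAdjRe M (L ^ k) ∘ₗ qvRe M (L ^ k)) ∘ₗ gOp M (L ^ k) a))
      (fun y y' => 2 * Real.exp δ / ((L ^ k : ℕ) : ℝ) * (C * Real.exp δ) * Real.exp (-(δ * tdistT M y y'))) :=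
  (hasMaj_ownDiff_comp_qvAdjRe M (L ^ k) (by positivity : 0 ≤ C * Real.exp δ) hδ (hasMaj_qvRe_comp M k (L ^ k) hC hδ hG)).congr fun μ => rfl

/-- ★★★ **THE η-DEFECT OF THE CUBE PROPAGATOR BEHIND `Q*Q` — dag-n15-c WANT-n15-a (g12-4), THE AVERAGING HALF** (any torus `M_ν = 2S`, `n = L^k`, `n′ = L^r·n`, King's `P` on both
sides): from the coarse letter `G ≤ Ce^{−δd}` (`hG`), the two-grid defect `𝔇(G′, G) ≤ C₀e^{−δd}` (`h0`) and the coarse gradients `∇_νG ≤ C₁e^{−δd}` (`h1`, `η⁻¹`-normalised),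
`𝔇(χ′_□∘Q*′Q′∘G′(□), χ_□∘Q*Q∘G(□)) ≤ 1_□(y)1_□(y′)·2^{d+1}e^{δ}·e^{δ}e^{δ}·(C₀ + (C₁ + 4C)∕L^k)·e^{−δ|y−y′|_T}` — `Q*Q` commutes with the images (§37), the sandwich's torus defect is
§39 `hasMaj_idef_qq_gOp`, its face term the own-direction stencil row `hasMaj_ownDiff_qq_gOp`.
[cite: Balaban1985BackgroundPropagators, Thm 3.14 pp.426–427 (difference template), (3.42) p.397 (shape); Balaban1984PropagatorsII, (2.37) p.229 (images), (2.133)–(2.134) p.247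
(shapes); Balaban1984PropagatorsI, (1.18) p.20, (1.69) p.29, Prop. 1.2 (1.110) p.35; King1986, p.664] -/
theorem hasMaj_idef_chiCube_qq_neumannCubeG_of (hM : ∀ ν, M ν = 2 * S) {a : ℝ} (ha : 0 < a) {C C₀ C₁ δ : ℝ} (hC : 0 ≤ C) (hC₀ : 0 ≤ C₀) (hC₁ : 0 ≤ C₁) (hδ : 0 ≤ δ)
    (hG : HasMaj (BlockNorm.ofBlocks (unitTorusGeo L k M) (fun b : Tor (fine (L ^ k) M) × Fin (d + 1) => blockOf (L ^ k) M b.1))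
      (BlockNorm.ofBlocks (unitTorusGeo L k M) (fun b : Tor (fine (L ^ k) M) × Fin (d + 1) => blockOf (L ^ k) M b.1)) (gOp M (L ^ k) a)
      (fun y y' => C * Real.exp (-(δ * tdistT M y y'))))
    (h0 : HasMaj (BlockNorm.ofBlocks (unitTorusGeo L k M) (fun b : Tor (fine (L ^ k) M) × Fin (d + 1) => blockOf (L ^ k) M b.1))
      (BlockNorm.ofBlocks (unitTorusGeo L k M) (fun b' : Tor (fine (L ^ r * L ^ k) M) × Fin (d + 1) => blockOf (L ^ r * L ^ k) M b'.1))
      (idef (pull (kingPrV L k r M)) (pull (kingPrV L k r M)) (gOp M (L ^ r * L ^ k) a) (gOp M (L ^ k) a)) (fun y y' => C₀ * Real.exp (-(δ * tdistT M y y'))))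
    (h1 : ∀ ν, HasMaj (BlockNorm.ofBlocks (unitTorusGeo L k M) (fun b : Tor (fine (L ^ k) M) × Fin (d + 1) => blockOf (L ^ k) M b.1))
      (BlockNorm.ofBlocks (unitTorusGeo L k M) (fun b : Tor (fine (L ^ k) M) × Fin (d + 1) => blockOf (L ^ k) M b.1))
      (symbOp M (L ^ k) (sD M (L ^ k) ν ((L ^ k : ℕ) : ℝ)) ∘ₗ gOp M (L ^ k) a) (fun y y' => C₁ * Real.exp (-(δ * tdistT M y y')))) :
    HasMaj (BlockNorm.ofBlocks (unitTorusGeo L k M) (fun b : Tor (fine (L ^ k) M) × Fin (d + 1) => blockOf (L ^ k) M b.1))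
      (BlockNorm.ofBlocks (unitTorusGeo L k M) (fun b' : Tor (fine (L ^ r * L ^ k) M) × Fin (d + 1) => blockOf (L ^ r * L ^ k) M b'.1))
      (idef (pull (kingPrV L k r M)) (pull (kingPrV L k r M))
        (mulOp (chiCube M (L ^ r * L ^ k) c S) ∘ₗ ((qvAdjRe M (L ^ r * L ^ k) ∘ₗ qvRe M (L ^ r * L ^ k)) ∘ₗ neumannCubeG M (L ^ r * L ^ k) c S a))
        (mulOp (chiCube M (L ^ k) c S) ∘ₗ ((qvAdjRe M (L ^ k) ∘ₗ qvRe M (L ^ k)) ∘ₗ neumannCubeG M (L ^ k) c S a)))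
      (fun y y' => ind (cubeBlocks M c S : Set (Tor M)) y * ind (cubeBlocks M c S : Set (Tor M)) y' *
        (2 ^ (d + 1) * Real.exp δ * (Real.exp δ * Real.exp δ * (C₀ + (C₁ + 4 * C) / (L ^ k : ℕ))) * Real.exp (-(δ * tdistT M y y')))) := by
  have hL0 : 0 < L := Nat.pos_of_ne_zero (NeZero.ne L)
  have hn : 1 ≤ L ^ k := Nat.one_le_pow _ _ hL0
  have hn' : 1 ≤ L ^ r * L ^ k := Nat.one_le_iff_ne_zero.mpr (Nat.mul_ne_zero (pow_ne_zero r (NeZero.ne L)) (by positivity))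
  have hn0 : (0 : ℝ) < ((L ^ k : ℕ) : ℝ) := by exact_mod_cast hn
  have hX0 := hasMaj_idef_qq_gOp (r := r) hC hC₀ hC₁ hδ hG h0 h1
  have hXD := hasMaj_ownDiff_qq_gOp hC hδ hG
  have key := hasMaj_idef_chiCube_symOp_sandwich_of_ownDiff (c := c) hM (by positivity) (by positivity) hδ hX0 hXD
  refine (key.congr fun μ => ?_).mono fun y y' => le_of_eq ?_
  · rw [idef_apply, idef_apply, mulOp_chiCube_qq_neumannCubeG M (L ^ r * L ^ k) c S hM hn' ha, mulOp_chiCube_qq_neumannCubeG M (L ^ k) c S hM hn ha]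
  · field_simp
    ring

end Row

end Summit.QuantumFields.YangMills.BalabanUVNodes.N15.TwoGrid
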